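import Literature.NumberTheory.GaloisRepresentations.GalLayerSystemLayers
import Literature.Algebra.Homology.DiscreteRepLayerColimitGroupCohomology
import Literature.Algebra.Homology.DiscreteRepInternalHom
import Literature.Algebra.Homology.TateNakayamaInflationVanishingHom
import HarnessLib

/-!
# Layers of `Hom(N, lim S)` for a lattice `N` with open stabilisers: at a layer `E` whose group `Gal(F̄/E)` acts
# trivially on `N`, `(Hom(N, lim S))^{Gal(F̄/E)} ≅ Hom(N_E, S.obj E)` as `Gal(E/F)`-modules, and door-c4's transitions
# are the maps `F ↦ base ∘ F` (Milne ADT I, proof of Lemma 1.9: `Extʳ_G(M, C) = lim→ Hʳ(G/U, Hom(M, C^U))`)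

Topic `NumberTheory/GaloisRepresentations`; namespace `Literature.NumberTheory.GaloisRepresentations.GalLayerData`.
Definitions with bodies and theorems; no named fact, no instance, no `sorry`.  Sequel to `GalLayerSystemLayers.lean`
(door-c5 g16: `D : GalLayerData F`, `D.layerRep E = (lim S)^{U_E}`, `D.layerEquiv E : (lim S)^{U_E} ≃ₗ D.V E`,
`layerEquiv_ρ_mk`, `layerEquiv_invariantsStepIncl`), door-c4's `DiscreteRepInternalHom` (`DiscreteRep.ihomObj N P =
Hom_k(N, P)` with the conjugation action, an object of `C_Γ` for `N` finitely generated) and door-c6 g15's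
`TateNakayamaInflationVanishingHom` (`ihomTransition`: `F ↦ ι ∘ F ∘ e`).

THE POINT.  The last class-formation hypothesis of door-c4's Tate duality theorem for `C̄` (USE-door-c4-g15 §1:
`ext_eq_zero_of_four_le`, through `tateDualityHypotheses_of_torsionFree`) is `hN`: `Extʳ_{C_Γ}(N, C̄) = 0` for `r ≥ 3`
and `N` a discrete `Γ_F`-LATTICE.  By door-c4's `extIhomAddEquivOfProjective` (Harari 16.16 (b)) this is
`Extʳ_{C_Γ}(ℤ, Hom(N, C̄)) = 0`, to be read on the layers of `Hom(N, C̄)` by the colimit theorem (d).  This file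
computes those layers for a general Galois layer system `S = D.toSystem` and a lattice `N` given by a representation
`ρN : Γ_F → GL(V)` with open stabilisers: if `U_E = Gal(F̄/E)` acts trivially on `V` (`TrivialOn ρN E`; such `E`
exist and are cofinal), then
* `coeff ρN E hE : Rep ℤ Gal(E/F)` — `V` with the descended action (`coeffRep_restrictHom`: `σ|_E ↦ ρN σ`);
* **`ihomLayerEquiv`**: `(Hom(V, lim S))^{U_E} ≃ₗ Hom_ℤ(V, D.V E)` (a `U_E`-invariant map takes values in
  `(lim S)^{U_E} = D.V E`), equivariant along `Γ_F ⧸ U_E ≃* Gal(E/F)` for the conjugation actions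
  (`ihomLayerEquiv_ρ_mk`), whence **`ihomLayerCohomologyIso E n :
  Hⁿ(Γ_F ⧸ U_E, (Hom(N, lim S))^{U_E}) ≅ Hⁿ(Gal(E/F), Hom(coeff E, D.obj E))`** (Mathlib `groupCohomology.mapIso`,
  `Rep.ihom`);
* **`stepG_comp_ihomLayerCohomologyIso`**: for `E ≤ M` door-c4's transition `stepG` IS
  `D.ihomInf ρN h n = Hⁿ(res_{M/E}, F ↦ D.base h ∘ F)` (door-c6's `ihomTransition` with `e = id`).

Written for Route A of the Poitou–Tate programme of crux `AnticycControlAdditiveK` (cell bsd-schneider, item 19295), seat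
door-c6 gen 15.  HONEST FRAMING: Galois-module bookkeeping only; no arithmetic statement and no case of BSD is proved.

## References
* J. S. Milne, *Arithmetic Duality Theorems* (2nd ed. 2006), I §1, Lemma 1.9 (proof). [MilneADT2006]
* D. Harari, *Galois Cohomology and Class Field Theory* (2020), §16.2 Def. 16.10, Prop. 16.16 (b); §16.3 Lemma
  16.20. [Harari2020]
* J.-P. Serre, *Galois Cohomology*, Springer (1997), I §2.2 Proposition 8. [SerreGaloisCohomology1997]
-/

noncomputable section

open CategoryTheory groupCohomology
open Field (absoluteGaloisGroup)
open Literature.Algebra.Homology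
open scoped Classical

namespace Literature.NumberTheory.GaloisRepresentations

open IdeleClassBar

/-! ## §1 The coefficient lattice at a layer acting trivially -/

section Coeff

variable {F : Type} [Field F] {V : Type} [AddCommGroup V] (ρN : Representation ℤ (absoluteGaloisGroup F) V)

/-- `Gal(F̄/E)` acts trivially on `V` through `ρN`. [cite: MilneADT2006, I Lemma 1.9] -/
def TrivialOn (E : GalLayer F) : Prop :=
  ∀ σ ∈ (E.openNormalSubgroup : Subgroup (absoluteGaloisGroup F)), ∀ x : V, ρN σ x = x

variable {ρN} in
/-- `TrivialOn` is monotone in the layer. [cite: MilneADT2006, I Lemma 1.9] -/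
theorem TrivialOn.mono {E E' : GalLayer F} (h : E ≤ E') (hE : TrivialOn ρN E) : TrivialOn ρN E' :=
  fun σ hσ x => hE σ (GalLayer.coe_openNormalSubgroup_le h hσ) x

variable {ρN} in
/-- `U_E ≤ ker ρN` under `TrivialOn`. [cite: MilneADT2006, I Lemma 1.9] -/
theorem TrivialOn.le_ker {E : GalLayer F} (hE : TrivialOn ρN E) :
    (E.openNormalSubgroup : Subgroup (absoluteGaloisGroup F)) ≤ ρN.ker := fun σ hσ =>
  LinearMap.ext (hE σ hσ)

variable [NumberField F]

/-- **The descended action of `Gal(E/F)` on `V`** (`σ|_E ↦ ρN σ`, well defined when `U_E` acts trivially):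
`QuotientGroup.lift` along `Γ_F ⧸ U_E ≃* Gal(E/F)`. [cite: MilneADT2006, I Lemma 1.9] -/
def coeffRep {E : GalLayer F} (hE : TrivialOn ρN E) : Representation ℤ (E.1 ≃ₐ[F] E.1) V :=
  (QuotientGroup.lift _ ρN hE.le_ker).comp E.quotEquiv.symm.toMonoidHom

/-- `coeffRep (σ|_E) = ρN σ`. [cite: MilneADT2006, I Lemma 1.9] -/
@[simp]
theorem coeffRep_restrictHom {E : GalLayer F} (hE : TrivialOn ρN E) (σ : absoluteGaloisGroup F) :
    coeffRep ρN hE (E.restrictHom σ) = ρN σ := by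
  rw [coeffRep, MonoidHom.comp_apply, MulEquiv.coe_toMonoidHom, GalLayer.quotEquiv_symm_restrictHom,
    QuotientGroup.lift_mk]

/-- `coeffRep` at `E ≤ M` is `coeffRep` at `E` after `res : Gal(M/F) → Gal(E/F)`. [cite: MilneADT2006, I Lemma 1.9] -/
theorem coeffRep_resHom {E M : GalLayer F} (h : E ≤ M) (hE : TrivialOn ρN E) (hM : TrivialOn ρN M)
    (τ : M.1 ≃ₐ[F] M.1) : coeffRep ρN hE (GalLayer.resHom h τ) = coeffRep ρN hM τ := by
  obtain ⟨σ, rfl⟩ := M.restrictHom_surjective τ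
  rw [GalLayer.resHom_restrictHom, coeffRep_restrictHom, coeffRep_restrictHom]

/-- **The coefficient lattice `N_E`**: `V` as a representation of `Gal(E/F)`. [cite: MilneADT2006, I Lemma 1.9] -/
abbrev coeff {E : GalLayer F} (hE : TrivialOn ρN E) : Rep ℤ (E.1 ≃ₐ[F] E.1) := Rep.of (coeffRep ρN hE)

end Coeff

namespace GalLayerData

variable {F : Type} [Field F] [NumberField F] (D : GalLayerData F)
variable {V : Type} [AddCommGroup V] (ρN : Representation ℤ (absoluteGaloisGroup F) V)
  (hρN : DiscreteRep.IsDiscrete (Rep.of ρN)) [Module.Finite ℤ V]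

/-- The lattice as an object of `C_Γ`. [cite: Harari2020, §16.2 Definition 16.10] -/
abbrev latticeD : DiscreteRepCat ℤ (absoluteGaloisGroup F) := DiscreteRep.mk (Rep.of ρN) hρN

/-! ## §2 The layer `(Hom(N, lim S))^{U_E} ≅ Hom(N_E, D.obj E)` -/

/-- **Door-c4's layer object of `Hom(N, lim S)` at `U_E`** (`(invariantsQuotFunctor ℤ U_E).obj (ihomObj N S.toD)`;
an abbreviation, so that `stepG` applies verbatim). [cite: SerreGaloisCohomology1997, I §2.2 Proposition 8] -/
abbrev ihomLayerRep (E : GalLayer F) :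
    Rep ℤ (absoluteGaloisGroup F ⧸ (E.openNormalSubgroup : Subgroup (absoluteGaloisGroup F))) :=
  (DiscreteRep.invariantsQuotFunctor ℤ (E.openNormalSubgroup : Subgroup (absoluteGaloisGroup F))).obj
    (DiscreteRep.ihomObj (latticeD ρN hρN) D.toSystem.toD)

/-- The underlying linear map `V → lim S` of a vector of the layer. [cite: MilneADT2006, I Lemma 1.9] -/
def ihomLayerFun {E : GalLayer F} (Φ : (D.ihomLayerRep ρN hρN E).V) : V →ₗ[ℤ] D.toSystem.limit := Φ.1

omit [NumberField F] in
/-- The values of a `U_E`-invariant map `Φ : V → lim S` are `U_E`-invariant when `U_E` acts trivially on `V`.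
[cite: MilneADT2006, I Lemma 1.9] -/
theorem apply_mem_invariants {E : GalLayer F} (hE : TrivialOn ρN E) (Φ : (D.ihomLayerRep ρN hρN E).V) (x : V) :
    D.ihomLayerFun ρN hρN Φ x ∈ Representation.invariants
      (D.toSystem.toRep.ρ.comp (E.openNormalSubgroup : Subgroup (absoluteGaloisGroup F)).subtype) := fun u => by
  have h := LinearMap.congr_fun (Φ.2 u) (ρN (u : absoluteGaloisGroup F) x)
  change D.toSystem.rep (u : absoluteGaloisGroup F)
      (D.ihomLayerFun ρN hρN Φ (ρN (u : absoluteGaloisGroup F)⁻¹ (ρN (u : absoluteGaloisGroup F) x))) =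
    D.ihomLayerFun ρN hρN Φ (ρN (u : absoluteGaloisGroup F) x) at h
  rw [← Module.End.mul_apply, ← map_mul, inv_mul_cancel, map_one, Module.End.one_apply, hE _ u.2 x] at h
  exact h

/-- A `U_E`-invariant map `V → lim S` as a map `V → (lim S)^{U_E} ≃ D.V E`. [cite: MilneADT2006, I Lemma 1.9] -/
def toCoeffHom {E : GalLayer F} (hE : TrivialOn ρN E) (Φ : (D.ihomLayerRep ρN hρN E).V) : V →ₗ[ℤ] D.V E :=
  letI := (D.layerRep E).hV2
  (D.layerEquiv E).toLinearMap ∘ₗ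
    LinearMap.codRestrict _ (D.ihomLayerFun ρN hρN Φ) (D.apply_mem_invariants ρN hρN hE Φ)

omit [NumberField F] in
/-- Formula: `of E (toCoeffHom Φ x) = Φ x` in `lim S`. [cite: MilneADT2006, I Lemma 1.9] -/
theorem of_toCoeffHom_apply {E : GalLayer F} (hE : TrivialOn ρN E) (Φ : (D.ihomLayerRep ρN hρN E).V) (x : V) :
    D.toSystem.of E (D.toCoeffHom ρN hρN hE Φ x) = D.ihomLayerFun ρN hρN Φ x :=
  D.of_layerEquiv E _

omit [NumberField F] in
/-- The lift `V → lim S` of a map `f : V → D.V E` (`x ↦ [f x]`) is `U_E`-invariant for the conjugation action.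
[cite: MilneADT2006, I Lemma 1.9] -/
theorem of_comp_mem_invariants {E : GalLayer F} (hE : TrivialOn ρN E) (f : V →ₗ[ℤ] D.V E) :
    ((D.toSystem.of E).toIntLinearMap ∘ₗ f) ∈ Representation.invariants
      ((DiscreteRep.ihomObj (latticeD ρN hρN) D.toSystem.toD).obj.ρ.comp
        (E.openNormalSubgroup : Subgroup (absoluteGaloisGroup F)).subtype) := fun u => by
  refine LinearMap.ext fun x => ?_
  change D.toSystem.rep (u : absoluteGaloisGroup F)
      (D.toSystem.of E (f (ρN (u : absoluteGaloisGroup F)⁻¹ x))) = D.toSystem.of E (f x)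
  rw [GalLayerSystem.rep_of_of_mem _ E u.2, hE _ (inv_mem u.2) x]

/-- The inverse: `f ↦ (x ↦ [f x])`. [cite: MilneADT2006, I Lemma 1.9] -/
def ofCoeffHom {E : GalLayer F} (hE : TrivialOn ρN E) (f : V →ₗ[ℤ] D.V E) : (D.ihomLayerRep ρN hρN E).V :=
  ⟨(D.toSystem.of E).toIntLinearMap ∘ₗ f, D.of_comp_mem_invariants ρN hρN hE f⟩

omit [NumberField F] in
/-- Formula. [cite: MilneADT2006, I Lemma 1.9] -/
theorem ihomLayerFun_ofCoeffHom_apply {E : GalLayer F} (hE : TrivialOn ρN E) (f : V →ₗ[ℤ] D.V E) (x : V) :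
    D.ihomLayerFun ρN hρN (D.ofCoeffHom ρN hρN hE f) x = D.toSystem.of E (f x) := rfl

omit [NumberField F] in
/-- `toCoeffHom (ofCoeffHom f) = f`. [cite: MilneADT2006, I Lemma 1.9] -/
theorem toCoeffHom_ofCoeffHom {E : GalLayer F} (hE : TrivialOn ρN E) (f : V →ₗ[ℤ] D.V E) :
    D.toCoeffHom ρN hρN hE (D.ofCoeffHom ρN hρN hE f) = f := by
  refine LinearMap.ext fun x => D.toSystem.of_injective E ?_
  rw [of_toCoeffHom_apply, ihomLayerFun_ofCoeffHom_apply]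

omit [NumberField F] in
/-- `ofCoeffHom (toCoeffHom Φ) = Φ`. [cite: MilneADT2006, I Lemma 1.9] -/
theorem ofCoeffHom_toCoeffHom {E : GalLayer F} (hE : TrivialOn ρN E) (Φ : (D.ihomLayerRep ρN hρN E).V) :
    D.ofCoeffHom ρN hρN hE (D.toCoeffHom ρN hρN hE Φ) = Φ := by
  refine Subtype.ext (LinearMap.ext fun x => ?_)
  exact (D.ihomLayerFun_ofCoeffHom_apply ρN hρN hE _ x).trans (D.of_toCoeffHom_apply ρN hρN hE Φ x)

/-- **The layer module: `(Hom(N, lim S))^{U_E} ≃ₗ[ℤ] Hom_ℤ(V, D.V E)`** (the codomain written as the module of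
`Hom(N_E, D.obj E)` = Mathlib `Rep.ihom`, so that `groupCohomology.mapIso` applies verbatim).
[cite: MilneADT2006, I Lemma 1.9][cite: Harari2020, §16.2 Definition 16.10] -/
def ihomLayerEquiv {E : GalLayer F} (hE : TrivialOn ρN E) :
    letI := (D.ihomLayerRep ρN hρN E).hV2
    letI := ((Rep.ihom (coeff ρN hE)).obj (D.obj E)).hV2
    (D.ihomLayerRep ρN hρN E).V ≃ₗ[ℤ] ((Rep.ihom (coeff ρN hE)).obj (D.obj E)).V :=
  letI := (D.ihomLayerRep ρN hρN E).hV2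
  letI := ((Rep.ihom (coeff ρN hE)).obj (D.obj E)).hV2
  { toFun := D.toCoeffHom ρN hρN hE
    map_add' := fun Φ Ψ => LinearMap.ext fun x => D.toSystem.of_injective E (by
      change D.toSystem.of E (D.toCoeffHom ρN hρN hE (Φ + Ψ) x) =
        D.toSystem.of E (D.toCoeffHom ρN hρN hE Φ x + D.toCoeffHom ρN hρN hE Ψ x)
      rw [of_toCoeffHom_apply, map_add, of_toCoeffHom_apply, of_toCoeffHom_apply]
      rfl)
    map_smul' := fun c Φ => LinearMap.ext fun x => D.toSystem.of_injective E (by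
      change D.toSystem.of E (D.toCoeffHom ρN hρN hE (c • Φ) x) =
        D.toSystem.of E (c • D.toCoeffHom ρN hρN hE Φ x)
      rw [of_toCoeffHom_apply, map_zsmul, of_toCoeffHom_apply]
      rfl)
    invFun := D.ofCoeffHom ρN hρN hE
    left_inv := D.ofCoeffHom_toCoeffHom ρN hρN hE
    right_inv := D.toCoeffHom_ofCoeffHom ρN hρN hE }

/-- Formula. [cite: MilneADT2006, I Lemma 1.9] -/
theorem ihomLayerEquiv_apply {E : GalLayer F} (hE : TrivialOn ρN E) (Φ : (D.ihomLayerRep ρN hρN E).V) :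
    D.ihomLayerEquiv ρN hρN hE Φ = D.toCoeffHom ρN hρN hE Φ := rfl

/-- **Equivariance, pointwise**: `ihomLayerEquiv ([σ] • Φ) = σ|_E • ihomLayerEquiv Φ` for the conjugation actions
(`[σ] • Φ = σ ∘ Φ ∘ ρN(σ)⁻¹`; `τ • f = D.ρ E τ ∘ f ∘ coeffRep τ⁻¹`). [cite: Harari2020, §16.2 Definition 16.10] -/
theorem ihomLayerEquiv_ρ_mk {E : GalLayer F} (hE : TrivialOn ρN E) (σ : absoluteGaloisGroup F)
    (Φ : (D.ihomLayerRep ρN hρN E).V) :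
    D.ihomLayerEquiv ρN hρN hE ((D.ihomLayerRep ρN hρN E).ρ (QuotientGroup.mk σ) Φ) =
      D.ρ E (E.restrictHom σ) ∘ₗ D.ihomLayerEquiv ρN hρN hE Φ ∘ₗ coeffRep ρN hE (E.restrictHom σ)⁻¹ := by
  refine LinearMap.ext fun x => D.toSystem.of_injective E ?_
  rw [ihomLayerEquiv_apply, of_toCoeffHom_apply, LinearMap.comp_apply, LinearMap.comp_apply, ← map_inv,
    coeffRep_restrictHom, ← GalLayerSystem.rep_of, ihomLayerEquiv_apply, of_toCoeffHom_apply]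
  rfl

/-- **The layers of `Hom(N, lim S)` have the cohomology of `Hom(N_E, D.obj E)`:
`Hⁿ(Γ_F ⧸ U_E, (Hom(N, lim S))^{U_E}) ≅ Hⁿ(Gal(E/F), Hom(N_E, D.obj E))`** (Mathlib `groupCohomology.mapIso` along
`quotEquiv` and `ihomLayerEquiv`; the equivariance is proved in place). [cite: MilneADT2006, I Lemma 1.9][cite: SerreGaloisCohomology1997, I §2.2 Proposition 8] -/
def ihomLayerCohomologyIso {E : GalLayer F} (hE : TrivialOn ρN E) (n : ℕ) :
    groupCohomology (D.ihomLayerRep ρN hρN E) n ≅ groupCohomology ((Rep.ihom (coeff ρN hE)).obj (D.obj E)) n :=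
  groupCohomology.mapIso (A := (Rep.ihom (coeff ρN hE)).obj (D.obj E)) (B := D.ihomLayerRep ρN hρN E)
    E.quotEquiv (D.ihomLayerEquiv ρN hρN hE)
    (fun g => QuotientGroup.induction_on g fun σ => LinearMap.ext fun Φ => by
      change D.ihomLayerEquiv ρN hρN hE ((D.ihomLayerRep ρN hρN E).ρ (QuotientGroup.mk σ) Φ) =
        D.ρ E (E.quotEquiv (QuotientGroup.mk σ)) ∘ₗ D.ihomLayerEquiv ρN hρN hE Φ ∘ₗ
          coeffRep ρN hE (E.quotEquiv (QuotientGroup.mk σ))⁻¹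
      rw [ihomLayerEquiv_ρ_mk, GalLayer.quotEquiv_mk_eq_restrictHom])
    n

/-! ## §3 The transitions are `F ↦ base ∘ F` -/

omit hρN [Module.Finite ℤ V] in
/-- The identity of `V` intertwines `coeffRep` at `M` with `coeffRep` at `E ≤ M` through `res`.
[cite: MilneADT2006, I Lemma 1.9] -/
theorem coeff_refl_comm {E M : GalLayer F} (h : E ≤ M) (hE : TrivialOn ρN E) (hM : TrivialOn ρN M)
    (τ : M.1 ≃ₐ[F] M.1) (x : V) :
    (LinearEquiv.refl ℤ V) ((coeff ρN hM).ρ τ x) = (coeff ρN hE).ρ (GalLayer.resHom h τ) ((LinearEquiv.refl ℤ V) x) := by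
  rw [LinearEquiv.refl_apply, LinearEquiv.refl_apply]
  exact congrArg (fun ρ => ρ x) (coeffRep_resHom ρN h hE hM τ).symm

/-- **The transition `Hom(N_E, D.obj E) → Hom(N_M, D.obj M)`, `F ↦ D.base h ∘ F`**, as the morphism
`Res_{res} Hom(N_E, D.obj E) ⟶ Hom(N_M, D.obj M)` (door-c6's `ihomTransition` with `e = id`).
[cite: Harari2020, §16.2 Definition 16.11] -/
abbrev ihomBaseRepHom {E M : GalLayer F} (h : E ≤ M) (hE : TrivialOn ρN E) (hM : TrivialOn ρN M) :
    Rep.res (GalLayer.resHom h) ((Rep.ihom (coeff ρN hE)).obj (D.obj E)) ⟶ (Rep.ihom (coeff ρN hM)).obj (D.obj M) :=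
  ihomTransition (GalLayer.resHom h) (D.obj E) (coeff ρN hE) (D.obj M) (coeff ρN hM) (D.baseRepHom h)
    (LinearEquiv.refl ℤ V) (coeff_refl_comm ρN h hE hM)

/-- **The inflation `Hⁿ(Gal(E/F), Hom(N_E, D.obj E)) → Hⁿ(Gal(M/F), Hom(N_M, D.obj M))`** along `(res, F ↦ base ∘ F)`.
[cite: MilneADT2006, I Lemma 1.9] -/
def ihomInf {E M : GalLayer F} (h : E ≤ M) (hE : TrivialOn ρN E) (hM : TrivialOn ρN M) (n : ℕ) :
    groupCohomology ((Rep.ihom (coeff ρN hE)).obj (D.obj E)) n ⟶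
      groupCohomology ((Rep.ihom (coeff ρN hM)).obj (D.obj M)) n :=
  groupCohomology.map (GalLayer.resHom h) (D.ihomBaseRepHom ρN h hE hM) n

/-- **The inclusion `(Hom(N, lim S))^{U_E} ⊆ (Hom(N, lim S))^{U_M}` is `F ↦ D.base h ∘ F`** under the `ihomLayerEquiv`s.
[cite: MilneADT2006, I Lemma 1.9] -/
theorem ihomLayerEquiv_invariantsStepIncl {E M : GalLayer F} (h : E ≤ M) (hE : TrivialOn ρN E)
    (hM : TrivialOn ρN M) (Φ : (D.ihomLayerRep ρN hρN E).V) :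
    D.ihomLayerEquiv ρN hρN hM ((DiscreteRep.invariantsStepIncl
        (E.openNormalSubgroup : Subgroup (absoluteGaloisGroup F))
        (M.openNormalSubgroup : Subgroup (absoluteGaloisGroup F)) (GalLayer.coe_openNormalSubgroup_le h)
        (DiscreteRep.ihomObj (latticeD ρN hρN) D.toSystem.toD)).hom Φ) =
      (D.ihomBaseRepHom ρN h hE hM).hom (D.ihomLayerEquiv ρN hρN hE Φ) := by
  refine LinearMap.ext fun x => D.toSystem.of_injective M ?_
  change D.toSystem.of M (D.toCoeffHom ρN hρN hM ((DiscreteRep.invariantsStepIncl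
        (E.openNormalSubgroup : Subgroup (absoluteGaloisGroup F))
        (M.openNormalSubgroup : Subgroup (absoluteGaloisGroup F)) (GalLayer.coe_openNormalSubgroup_le h)
        (DiscreteRep.ihomObj (latticeD ρN hρN) D.toSystem.toD)).hom Φ) x) =
    D.toSystem.of M (D.base h (D.toCoeffHom ρN hρN hE Φ x))
  rw [of_toCoeffHom_apply, GalLayerSystem.of_base, of_toCoeffHom_apply]
  rfl

set_option maxHeartbeats 1600000 in
-- the two `groupCohomology.map` composites are compared through Mathlib's generic `map_comp` / the cell's
-- `map_congr'`; the `ℤ`-instance paths are what needs the heartbeats (cf. `GalLayerSystemSubgroupLayers`)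
/-- **`stepG ≫ iso_M = iso_E ≫ ihomInf` for `E ≤ M`**: door-c4's transition between the layers of `Hom(N, lim S)` IS
the inflation `F ↦ base ∘ F` of the `Hom`-system (both are `groupCohomology.map` along the same homomorphism
`Gal(M/F) → Γ_F ⧸ U_E` with the same underlying map). [cite: MilneADT2006, I Lemma 1.9][cite: SerreGaloisCohomology1997, I §2.2 Proposition 8] -/
theorem stepG_comp_ihomLayerCohomologyIso {E M : GalLayer F} (h : E ≤ M) (hE : TrivialOn ρN E)
    (hM : TrivialOn ρN M) (n : ℕ) :
    DiscreteRep.LayerColimit.stepG E.openNormalSubgroup M.openNormalSubgroup (GalLayer.coe_openNormalSubgroup_le h)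
        (DiscreteRep.ihomObj (latticeD ρN hρN) D.toSystem.toD) n ≫ (D.ihomLayerCohomologyIso ρN hρN hM n).hom =
      (D.ihomLayerCohomologyIso ρN hρN hE n).hom ≫ D.ihomInf ρN h hE hM n := by
  rw [ihomLayerCohomologyIso, ihomLayerCohomologyIso, groupCohomology.mapIso_hom, groupCohomology.mapIso_hom,
    ihomInf, ← groupCohomology.map_comp, ← groupCohomology.map_comp]
  refine map_congr' (GalLayer.quotMap_comp_quotEquiv_symm_eq h) _ _ (fun Φ => ?_) n
  exact D.ihomLayerEquiv_invariantsStepIncl ρN hρN h hE hM Φ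

/-- Elementwise form: `iso_M (stepG c) = ihomInf (iso_E c)`. [cite: MilneADT2006, I Lemma 1.9] -/
theorem ihomLayerCohomologyIso_stepG {E M : GalLayer F} (h : E ≤ M) (hE : TrivialOn ρN E) (hM : TrivialOn ρN M)
    (n : ℕ) (c : groupCohomology (D.ihomLayerRep ρN hρN E) n) :
    (D.ihomLayerCohomologyIso ρN hρN hM n).hom (DiscreteRep.LayerColimit.stepG E.openNormalSubgroup
        M.openNormalSubgroup (GalLayer.coe_openNormalSubgroup_le h)
        (DiscreteRep.ihomObj (latticeD ρN hρN) D.toSystem.toD) n c) =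
      D.ihomInf ρN h hE hM n ((D.ihomLayerCohomologyIso ρN hρN hE n).hom c) := by
  rw [← CategoryTheory.comp_apply, ← CategoryTheory.comp_apply, stepG_comp_ihomLayerCohomologyIso]

end GalLayerData

end Literature.NumberTheory.GaloisRepresentations

end
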